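import Mathlib
import HarnessLib
import HarnessLib.Audit
import Summits.CriticalPhenomena.Statement
import Literature.Probability.RandomPlanarGeometry.ChordalCurveFamily
import Literature.Probability.RandomPlanarGeometry.LoopSpaceMaps
import HarnessLib.Audit.Status.Attr

/-!
Route: SAWPtolemyBoundary

# Route SAWPtolemyBoundary — the polymer's boundary is a Ptolemy circle — germ-free SAW cross-ratios
+ rank-one bumps force the Ptolemy coordinate to flow by Loewner; R* holds, limit = SLE(8/3)

It suffices to show X = BoundaryPtolemy ∧ RankOneBumps ∧ PtolemyLoewnerRigidity ∧ AxiomsOfLimit ∧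
LimitExists (route realising the
critic-graded new-mechanism card ptolemy-boundary-loewner-rigidity; AxiomsOfLimit, LimitExists and
the supports are the items of route
SAWRestrictionRigidity re-asked verbatim, whose rank-2 conjecture R* this line replaces by a device
plus two lattice rank conditions).
BoundaryPtolemy (lattice, germ-free): for ONE exponent p > 0, in every conformal rectangle (Ω; a, b,
c, d) and for all lattice
approximations of the four marks, the two cross-ratios X₁ = (Z_ac Z_bd / Z_ab Z_cd)^p, X₂ = (Z_ac
Z_bd / Z_ad Z_bc)^p of critical SAW
partition functions Z = total mass of SAW.weight converge as δ → 0+ to limits with X₁ + X₂ = 1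
(Ptolemy's equality: the semi-metric
Z^(-p) on ∂Ω is a Ptolemy circle; Kennedy–Lawler germ factors cancel identically). RankOneBumps
(lattice, law-visible): for three marks
u, v, w and a boundary point ξ after w, the probabilities h(u,w), h(u,v), h(v,w) that the critical
SAW chord of (Ω; ·, ·) leaves the
closure of Ω minus a non-degenerate ε-bump at ξ satisfy √h(u,w) = √h(u,v) + √h(v,w) up to relative
error → 0 as ε → 0 (eventually in
δ): the bump response has rank one. PtolemyLoewnerRigidity (continuum device + passage): these two
rank conditions, for a full
scaling-limit family P of the SAW carrying the lattice-exact axioms (restriction,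
restriction-coupled Markov, reversal, lattice
similarities, conjugation, simplicity), force P to be conformally covariant — because the Ptolemy
coordinate Θ_t of the slit domains is
forced to be a Loewner chain (V-lemma) and LSW03 Prop. 5.3 read backwards gives W = √(8/3)B, b =
5/8, up to a real-linear map that the
quarter-turn kills. Then LSW03 at κ = 8/3 (LSWRestrictionFact83, hypothesis-free support) identifies
every P D as chordal SLE_(8/3).
Lean: `BoundaryPtolemy ∧ RankOneBumps ∧ PtolemyLoewnerRigidity ∧ AxiomsOfLimit ∧ LimitExists`

## Assembly
Pure logic, proved sorry-free in Sketch.lean and rendered as the deciding theorem `closes`: from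
LimitExists take P; AxiomsOfLimit gives the
six axioms of P; PtolemyLoewnerRigidity fed with BoundaryPtolemy and RankOneBumps gives
P.IsConformallyCovariant; LSWRestrictionFact83
gives IsSLELaw (8/3) D (P D) = law of an SLE_(8/3) curve Γ; SAW.aemeasurable_curve + integral_map
turn TendstoLaw … id (P D) into
ConvergesInLawToSLE (8/3) for every Dobrushin domain and endpoint approximation, i.e.
SAWScalingLimit. Every crux is used.

Rationale: WHY THIS LINE. Every restriction argument in print (LawlerSchrammWerner2003Restriction §3–5,
LawlerSchrammWerner2004SAW §4, FriedrichWerner2003,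
DoyonRivaCardy2006 §6) STARTS from conformal maps; route SAWRestrictionRigidity conjectures that
exact restriction + Markov + lattice
similarities already force conformal covariance (R*) but names no device (its own why-it-might-fail:
"no technique known"). This line
asks what the boundary two-point data of a restriction–Markov family look like WITHOUT a conformal
structure: the germ-free cross-ratio
X_D(a,b,c,d) = Z(a,c)Z(b,d)/(Z(a,b)Z(c,d)) defines a Möbius class on ∂D; if it is Ptolemaic (one
modulus per cyclic quadruple, not two)
there is a boundary homeomorphism θ_D linearising Z^(-1/2b) — a law-visible rival of the Riemann map
— and restriction plus rank-one bump
response force θ_t of the slit domains to satisfy Loewner's equation with a pole at the growth point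
(the V-lemma: R[V] = −(G(U)−G(W))²
has only the pole solution mod psl₂, checked to order δ⁴ and by exact linear algebra by the card's
author), after which the LSW03 §5
martingale computation (h_t'(W_t)^b a martingale for every hull) runs BACKWARDS with W unknown and
returns drift 0, ⟨W⟩ = (8/3)t,
b = 5/8. Imported areas: conformal-restriction/Loewner calculus (run without conformal input),
Ptolemaic metric geometry (Ptolemy-circle
characterisation, Schoenberg; the Mostow-rigidity pattern "boundary semi-metric + dynamics ⇒
conformality", doi:10.1515/9781400881833,
as analogy only), Kennedy–Lawler lattice-factor bookkeeping (KennedyLawler2013, arXiv:1008.4321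
§3.1) which the cross-ratio and the
same-bump ratios cancel exactly. What prior routes do not:
RestrictionRigidity/InfinitesimalRigidity/RestrictionDescent/ZoomRigidity posit
rigidity of the LAW family with no boundary object; observable routes need the missing half of
Cauchy–Riemann; here conformal content is
localised in two rank statements about boundary partition-function data, both numerically testable
(Pythagoras test 2p → 8/5), and b
is output. Negatives index: no refuted statement concerns boundary cross-ratios or bump additivity;
the all-δ tightness stmt-0772 is
avoided (everything eventual in δ).

RANKED CRUXES. #2 BoundaryPtolemy (crux) — lattice Ptolemy (card K1): there is ONE p > 0 such that
for every conformal rectangle R = (Ω; a, b, c, d) and lattice points q_i(δ) ∈ Ω_δ with δ·q_i(δ) →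
R.pt i, pairwise joined in Ω_δ eventually, the germ-free cross-ratios X₁(δ) = (Z₀₂Z₁₃/(Z₀₁Z₂₃))^p
and X₂(δ) = (Z₀₂Z₁₃/(Z₀₃Z₁₂))^p of the critical SAW partition functions Z_ij = (SAW.weight Ω δ q_i
q_j)(univ) converge as δ → 0+ to X₁, X₂ with X₁ + X₂ = 1 (then p = 1/(2b); conformal prediction p =
4/5, square corners Z_side/Z_diag → 2^(5/8)). [difficulty: open-problem] (why it might fail:
value-laden asymptotics of ratios of SAW generating functions with DIFFERENT endpoints (hardness
class of the 5/8 law, though map-free); an exotic ℤ² limit with a second boundary modulus violates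
it; enumeration L ≤ 6 gives 2p* = 1.44…1.49, still far from 8/5.) [KennedyLawler2013,
arXiv:1008.4321, LawlerSchrammWerner2004SAW, arXiv:1210.7924]
#3 RankOneBumps (crux) — lattice rank-one bump response (card K3, macroscopic-bump form,
law-visible): for a conformal rectangle R with marks u = pt 0, v = pt 1, w = pt 2, ξ = pt 3 and
lattice approximations of u, v, w, for every θ ∈ (0,1] and η > 0 there is ε₀ > 0 such that for every
conformal rectangle R' ⊆ R with the same u, v, w, obtained by removing from Ω a bump inside B(ξ, ε)
that contains Ω ∩ B(ξ, θε), ε < ε₀, eventually in δ: |√h₀₂ − √h₀₁ − √h₁₂| ≤ η√h₀₂ where h_ij = 1 −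
P_δ^(Ω; q_i, q_j)(curve ⊆ closure Ω') (the SAW chord of the BIG domain leaves the bumped one). For
SLE(8/3): h ≈ (5/8)·a·(F(u)−F(w))², F = 1/(φ(·)−φ(ξ)), exactly additive. [difficulty: L] (why it
might fail: rank one is the boundary stress-tensor Ward identity in disguise (single weight-2
channel); a c = 0 logarithmic partner of T could enter at the same order ε²; uniformity of ε₀ over
bump shapes needs the dipole term to dominate uniformly (θ-nondegeneracy is the guard).)
[DoyonRivaCardy2006, FriedrichWerner2003, LawlerSchrammWerner2003Restriction, arXiv:math-ph/0301018]
#4 PtolemyLoewnerRigidity (crux) — the device, at use level (card K2 + passage to the limit):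
assuming BoundaryPtolemy and RankOneBumps, every chordal family P that is the full scaling limit of
the critical δℤ² SAW laws (for every Dobrushin domain and endpoint approximation) and has two-sided
restriction, a restriction-coupled Markov extension, reversibility, covariance under z ↦ r·i^k·z + w
and conjugation, and simple boundary-avoiding curves, is conformally covariant
(ChordalFamily.IsConformallyCovariant). Content: (a) the germ-free boundary data of P (cross-ratio
limits, same-bump avoidance ratios) define C³ Ptolemy coordinates θ_D with finite-order
singularities at growth points; (b) the continuum theorem: Ptolemy + rank one + restriction + Markov
+ dilations/translations force θ_t to flow by Loewner (V-lemma), LSW03 Prop. 5.3 backwards gives W =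
√(8/3)B and b = 5/8 up to a real-linear f fixing ℝ, and D4 forces f = id. [deps: BoundaryPtolemy,
RankOneBumps] [difficulty: XL] (why it might fail: (i) extracting the driving process W_t =
Θ_t(γ(t)) needs a semimartingale / conditional fourth-moment a-priori without harmonic measure; (ii)
hull map ⇒ point map for thin hulls; (iii) C³ regularity and non-degenerate 3-jets of the limit's
Ptolemy coordinates must come from lattice data.) [LawlerSchrammWerner2003Restriction, Schramm2000,
KemppainenSmirnov2017, Beffara2008Universal]
#5 AxiomsOfLimit (crux) — shared with route SAWRestrictionRigidity (stmt-CriticalPhenomena-1370,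
verbatim): every chordal family that is the full scaling limit of the critical δℤ² SAW laws inherits
the lattice-exact axioms — restriction, restriction-coupled Markov extension, reversibility,
covariance under z ↦ r·i^k·z + w and conjugation, simplicity and boundary avoidance. [difficulty: L]
(why it might fail: Markov passage needs stability of SAW limits in slit domains perturbed near the
tip; simplicity/boundary avoidance need no-crawling estimates not in print; restriction passage
needs null touching; largest-component bookkeeping.) [LawlerSchrammWerner2004SAW, Werner2007,
KennedyLawler2013]
#6 LimitExists (crux) — shared with route SAWRestrictionRigidity (stmt-CriticalPhenomena-1371,
verbatim): the full scaling limit of the critical δℤ² SAW exists as a chordal curve family (∃ P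
chordal with (lim) for every Dobrushin domain and every endpoint approximation; not identified
here). [difficulty: open-problem] (why it might fail: eventual tightness of critical SAW is open (no
annulus-crossing bound at x_c); uniqueness of subsequential limits rests on avoidance-ratio
convergence; an approximation-dependent limit refutes the conjunct itself.)
[LawlerSchrammWerner2004SAW, KemppainenSmirnov2017, AizenmanBurchard1999]
#9 EventualTight (support) — shared support (stmt-CriticalPhenomena-1372, verbatim): eventual
tightness (∃ δ₀) of the pushed-forward critical SAW laws for every Dobrushin domain and endpoint
approximation — child-designate of LimitExists; the repaired form of the refuted all-δ stmt-0772.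
[difficulty: open-problem] [KemppainenSmirnov2017, AizenmanBurchard1999]
#9 LSWRestrictionFact83 (support) — shared support (stmt-CriticalPhenomena-3017, verbatim): LSW03 at
κ = 8/3 in hypothesis-free form — a chordal, conformally covariant, restriction family carried by
simple boundary-avoiding curves is chordal SLE_(8/3) in every domain (existence/uniqueness in law
are library theorems at 8/3). [difficulty: M] [LawlerSchrammWerner2003Restriction]

TWO-LAYER PLAN. PtolemyLoewnerRigidity ⇐ AbstractPtolemyRigidity (continuum theorem over germ-free
boundary data of a restriction–Markov family on explored
configurations, needs definition PtolemyBoundaryData) → BoundaryDataOfLimit (K1, K3 and same-bump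
avoidance ratios pass to C³ Ptolemy
coordinates of the limit) → PtolemyLoewnerRigidity. LimitExists ⇐ EventualTight → simple
subsequential limits + uniqueness from
avoidance-ratio convergence (RR's AvoidanceCocycleLimit + the proved AvoidanceDeterminesLaw) →
LimitExists. BoundaryPtolemy ⇐ existence of
cross-ratio limits (ratio-limit / screening technology of SAWCircleScreening) → the value relation
X₁ + X₂ = 1.

KILL CRITERIA. ¬BoundaryPtolemy by certified numerics/enumeration (2p*(L) extrapolating away from
8/5, or two quadruples forcing different p) closes the
route refuted:BoundaryPtolemy AND is major negative knowledge (the ℤ² SAW limit, if it exists, is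
not conformally invariant). A restriction–
Markov simple-chord family with Ptolemaic boundary data and rank-one bumps that is not a real-linear
image of SLE(8/3) refutes the device
(¬PtolemyLoewnerRigidity in its abstract part): pivot to RR's bare R* or close. ¬RankOneBumps alone
(a second ε² channel) ⇒ restate with
the measured rank (the device needs rank one; rank two would kill the line). Rigidity (RR r2) proved
elsewhere moots r4 (this route then
reduces to RR); HexConjecture + HexTransfer proved elsewhere moots everything.

NOT DECOMPOSED YET. The abstract continuum theorem is not filed separately (its habitat — boundary
data on slit configurations — needs a definition item);
regularity (C³, 3-jet non-degeneracy) of limiting Ptolemy coordinates; existence of cross-ratio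
limits separately from their relation;
the whole tightness/uniqueness package under LimitExists (shared with RR, CircleScreening,
RenewalTightness).

CHEAPEST FALSIFIER. The lattice Pythagoras test: for L×L squares Z_side/Z_diag must tend to 2^(5/8)
= 1.5422 (2p* := ln 2 / ln(Z_side/Z_diag) → 8/5). RUN
(this seat, exp/sawsq.c, exact enumeration, x_c = 0.379052277758): n = 3…7 vertices: ratio 1.6203,
1.6304, 1.6183, 1.6044, 1.5928;
2p* = 1.436, 1.418, 1.440, 1.466, 1.489 (diagonal counts 12, 184, 8512, 1262816, 575780564 = OEIS
A007764) — replicates the card's table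
exactly; monotone toward 8/5 from L = 3 but far. A 4-point check at n = 5 (corner, top-mid, corner,
bottom-mid) shows O(0.1) Ptolemy
defects at every p (points two lattice units apart): enumeration cannot decide; the decisive run is
a corner/midpoint transfer-matrix
computation to L ≈ 15–20 (Guttmann–Kennedy arXiv:1210.7924 technology) — a kit job for the refuter.
Continuum: the V-lemma (a third
solution family of R[V] = −(G(U)−G(W))² beyond pole ⊕ psl₂ kills the device) — checked by the card's
author to order δ⁴ and by exact
linear algebra (6-dimensional linearised solution space).

NUMBERS. b = 5/8 (boundary 1-leg exponent, LSW03 Prop. 5.3 / LSW04 Prediction 5), hence p = 1/(2b) =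
4/5 and Pythagoras exponent 2p = 8/5;
square-corner ratio 2^(5/8) = 1.5422; bump exponent 2 (weight of T); κ = 8/3 from ⟨W⟩ = (8/3)·t.
x_c(ℤ²) = 1/μ, μ = 2.63815853 (numerical;
Lean uses SAW.criticalFugacity). Items at open: 8 (5 cruxes, 2 supports, assembly).

DEFINITION REQUESTS. PtolemyBoundaryData (topic Summits/CriticalPhenomena/SAWScalingLimit/Theorems):
germ-free boundary data of a chordal family on explored
configurations — cross-ratio datum on cyclic boundary quadruples of (remaining) domains + Ptolemy
coordinate θ and its regularity class —
the habitat of the abstract continuum theorem behind PtolemyLoewnerRigidity (filed after open, --for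
the r4 item). SAW.boundaryCrossRatio
(Literature/Probability/RandomPlanarGeometry) would shorten BoundaryPtolemy but is not needed
(stated inline over SAW.weight).

Novelty: Searches (2026-08-16, this seat; searchd FTS unavailable, OpenAlex budget exhausted, S2 partly
rate-limited — logged): `lit search '"Ptolemy" restriction measure SLE'` (S2 8 + crossref 8: Wang
arXiv:1810.04578, Gordina–Qian–Wang arXiv:2407.09426, Aru–Bordereau arXiv:2405.20148 — all
conformal); `lit search 'cross-ratio "self-avoiding walk" partition function boundary points'`
(crossref 8, none relevant); `lit search 'Ptolemaic metric conformal structure boundary rigidity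
Moebius'` (crossref: Mostow 1973 §20 "The boundary semi-metric" — analogy); `lit galaxy search
"Ptolemy" --star all` (30 rows, no mathematics of this kind), `"cross-ratio of partition functions"
--star pdf` (0), `"Ptolemy equality" --star pdf` (0), `"restriction property" --star pdf` (8,
unrelated); `lit vsearch` ×2 (Lawler 2005 p.30, conformal; 0 papers); the card's critic (2026-08-16)
ran openalex 'restriction property without conformal invariance … Loewner … Markov' (12 rows, all
conformal) and hybrid ×4. In-tree: 59 Theses read by header, 155 cards by title,
RR/LoopLift/ChordalCurveFamily in full.
Nearest prior art found: LawlerSchrammWerner2003Restriction §5 Prop. 5.3 (forward computation,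
conformal h_t); DoyonRivaCardy2006 §6 and FriedrichWerner2003 (bump/dipole response of CONFORMAL
restriction measures); KennedyLawler2013 + arXiv:1008.4321 §3.1 (lattice factors that the
cross-ratio kills); route SAWRestrictionRigidity (R* conjectured, no device); cards
saw-rw-cardy-formula / polymer-crossing-formula (  [refs: 1810.04578, 2407.09426, 2405.20148, 1008.4321, DoyonRivaCardy2006, FriedrichWerner2003, KennedyLawler2013]

Barriers (technique_class: boundary-moebius-rigidity, restriction-backwards): - technique_class: boundary-moebius-rigidity, restriction-backwards
- Literature.Barriers.CriticalPhenomena.ScaleCovarianceNotMoebius: evaded — the upgrade is not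
model-blind from Euclidean + scale covariance of correlation families; it uses exact restriction +
Markov of a CURVE family plus boundary Ptolemy + rank-one bumps; the barrier's witnesses
(inverse-power two-point, product four-point functions; no curve, no Markov) fail
restriction/Markov, and linear stretches are exactly the residual f the theorem outputs before the
quarter-turn.
- Literature.Barriers.CriticalPhenomena.EmbeddingModulusUniqueness: embraced — on a sheared lattice
the same argument returns sheared SLE(8/3); D4 (quarter-turn) is the embedding-specific input, spent
in the last line.
- Literature.Barriers.CriticalPhenomena.ParafermionicHalfCauchyRiemann: not engaged — no
discrete-holomorphic observable, vertex relation or boundary-value problem; the lattice cruxes are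
asymptotics of ratios of partition functions between boundary points.
- Literature.Barriers.CriticalPhenomena.NienhuisWeightsExcludeVertexSAW: not engaged — no integrable
weights; plain x_c-SAW on ℤ² throughout.
- Literature.Barriers.CriticalPhenomena.SAWNoUnitaryCFT: not met — no positivity/unitarity; the only
CFT shadow is the single weight-2 channel in RankOneBumps, flagged there as the place a c = 0
logarithmic partner could bite.
- Literature.Barriers.CriticalPhenomena.SAWNotKineticallyGrown: respected — Markov is the exact
conditional

sub-problem: SAWScalingLimit · status: open · opened planner-plan-novel-CriticalPhenomena-SAWScaling-8a38611a-0 2026-08-16T14:13:39Z · rev 3 · ledger route-CriticalPhenomena-SAWPtolemyBoundary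
GENERATED by the gate from the ledger (D-0016/17). Provers cite these decls: `theorem foo : Summit.CriticalPhenomena.SAWScalingLimit.Theses.SAWPtolemyBoundary.<Decl> := …` in Summits/CriticalPhenomena/SAWScalingLimit/Theorems/<Name>.lean.
-/

namespace Summit.CriticalPhenomena.SAWScalingLimit.Theses.SAWPtolemyBoundary

open scoped BigOperators Topology Manifold Classical MeasureTheory ProbabilityTheory Matrix InnerProductSpace ComplexConjugate ContinuousMap
open Filter Set Function TopologicalSpace MeasureTheory

attribute [summit_statement] _root_.SAWScalingLimit

/-- item stmt-CriticalPhenomena-15263 · crux · rank 2 · open · by planner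
why it might fail: value-laden asymptotics of ratios of SAW generating functions with DIFFERENT endpoints (hardness class of the 5/8 law, though map-free); an exotic ℤ² limit with a second boundary modulus violates it; enumeration L ≤ 6 gives 2p* = 1.44…1.49, still far from 8/5.
sources: KennedyLawler2013, arXiv:1008.4321, LawlerSchrammWerner2004SAW, arXiv:1210.7924
[crux] lattice Ptolemy (card K1): there is ONE p > 0 such that for every conformal rectangle R = (Ω;
a, b, c, d) and lattice points q_i(δ) ∈ Ω_δ with δ·q_i(δ) → R.pt i, pairwise joined in Ω_δ
eventually, the germ-free cross-ratios X₁(δ) = (Z₀₂Z₁₃/(Z₀₁Z₂₃))^p and X₂(δ) = (Z₀₂Z₁₃/(Z₀₃Z₁₂))^p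
of the critical SAW partition functions Z_ij = (SAW.weight Ω δ q_i q_j)(univ) converge as δ → 0+ to
X₁, X₂ with X₁ + X₂ = 1 (then p = 1/(2b); conformal prediction p = 4/5, square corners Z_side/Z_diag
→ 2^(5/8)). [difficulty: open-problem] -/
@[route_item "route-CriticalPhenomena-SAWPtolemyBoundary", crux]
def BoundaryPtolemy : Prop :=
  ∃ p : ℝ, 0 < p ∧ ∀ (R : Literature.Probability.RandomPlanarGeometry.ConformalRectangle) (q : Fin 4 → ℝ → Literature.Probability.LatticeModels.Site 2), (∀ i, Filter.Tendsto (fun δ => Literature.Probability.LatticeModels.meshPoint δ (q i δ)) (nhdsWithin 0 (Set.Ioi 0)) (nhds (R.pt i))) → (∀ i j, i ≠ j → ∀ᶠ δ in nhdsWithin 0 (Set.Ioi 0), (Literature.Probability.LatticeModels.discreteDomainGraph R.carrier δ).Reachable (q i δ) (q j δ)) → ∃ X₁ X₂ : ℝ, X₁ + X₂ = 1 ∧ Filter.Tendsto (fun δ => ((((Literature.Probability.RandomPlanarGeometry.SAW.weight R.carrier δ (q 0 δ) (q 2 δ)) Set.univ).toReal * ((Literature.Probability.RandomPlanarGeometry.SAW.weight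 R.carrier δ (q 1 δ) (q 3 δ)) Set.univ).toReal) / (((Literature.Probability.RandomPlanarGeometry.SAW.weight R.carrier δ (q 0 δ) (q 1 δ)) Set.univ).toReal * ((Literature.Probability.RandomPlanarGeometry.SAW.weight R.carrier δ (q 2 δ) (q 3 δ)) Set.univ).toReal)) ^ p) (nhdsWithin 0 (Set.Ioi 0)) (nhds X₁) ∧ Filter.Tendsto (fun δ => ((((Literature.Probability.RandomPlanarGeometry.SAW.weight R.carrier δ (q 0 δ) (q 2 δ)) Set.univ).toReal * ((Literature.Probability.RandomPlanarGeometry.SAW.weight R.carrier δ (q 1 δ) (q 3 δ)) Set.univ).toReal) / (((Literature.Probability.RandomPlanarGeometry.SAW.weight R.carrier δ (q 0 δ) (q 3 δ)) Set.univ).toReal * ((Literature.Probability.RandomPlanarGeometry.SAW.weight R.carrier δ (q 1 δ) (q 2 δ)) Set.univ).toReal)) ^ p) (nhdsWithin 0 (Set.Ioi 0)) (nhds X₂)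

/-- item stmt-CriticalPhenomena-15264 · crux · rank 3 · open · by planner
why it might fail: rank one is the boundary stress-tensor Ward identity in disguise (single weight-2 channel); a c = 0 logarithmic partner of T could enter at the same order ε²; uniformity of ε₀ over bump shapes needs the dipole term to dominate uniformly (θ-nondegeneracy is the guard).
sources: DoyonRivaCardy2006, FriedrichWerner2003, LawlerSchrammWerner2003Restriction, arXiv:math-ph/0301018
[crux] lattice rank-one bump response (card K3, macroscopic-bump form, law-visible): for a conformal
rectangle R with marks u = pt 0, v = pt 1, w = pt 2, ξ = pt 3 and lattice approximations of u, v, w,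
for every θ ∈ (0,1] and η > 0 there is ε₀ > 0 such that for every conformal rectangle R' ⊆ R with
the same u, v, w, obtained by removing from Ω a bump inside B(ξ, ε) that contains Ω ∩ B(ξ, θε), ε <
ε₀, eventually in δ: |√h₀₂ − √h₀₁ − √h₁₂| ≤ η√h₀₂ where h_ij = 1 − P_δ^(Ω; q_i, q_j)(curve ⊆ closure
Ω') (the SAW chord of the BIG domain leaves the bumped one). For SLE(8/3): h ≈ (5/8)·a·(F(u)−F(w))²,
F = 1/(φ(·)−φ(ξ)), exactly additive. [difficulty: L] -/
@[route_item "route-CriticalPhenomena-SAWPtolemyBoundary", crux]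
def RankOneBumps : Prop :=
  ∀ (R : Literature.Probability.RandomPlanarGeometry.ConformalRectangle) (q : Fin 3 → ℝ → Literature.Probability.LatticeModels.Site 2), (∀ i : Fin 3, Filter.Tendsto (fun δ => Literature.Probability.LatticeModels.meshPoint δ (q i δ)) (nhdsWithin 0 (Set.Ioi 0)) (nhds (R.pt i.castSucc))) → (∀ i j : Fin 3, i ≠ j → ∀ᶠ δ in nhdsWithin 0 (Set.Ioi 0), (Literature.Probability.LatticeModels.discreteDomainGraph R.carrier δ).Reachable (q i δ) (q j δ)) → ∀ θ : ℝ, 0 < θ → ∀ η : ℝ, 0 < η → ∃ ε₀ : ℝ, 0 < ε₀ ∧ ∀ (R' : Literature.Probability.RandomPlanarGeometry.ConformalRectangle) (ε : ℝ), 0 < ε → ε < ε₀ → R'.carrier ⊆ R.carrier → (∀ i : Fin 3, R'.pt i.castSucc = R.pt i.castSucc) → R.carrier \ R'.carrier ⊆ Metric.ball (R.pt 3) ε → R.carrier ∩ Metric.ball (R.pt 3) (θ * ε) ⊆ R.carrier \ R'.carrier → ∀ᶠ δ in nhdsWithin 0 (Set.Ioi 0), |Real.sqrt (1 - (((Literature.Probability.RandomPlanarGeometry.SAW.law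 R.carrier δ (q 0 δ) (q 2 δ)).map (fun γ => γ.curve)) (Literature.Probability.RandomPlanarGeometry.CurveClass.rangeSubset (closure R'.carrier))).toReal) - Real.sqrt (1 - (((Literature.Probability.RandomPlanarGeometry.SAW.law R.carrier δ (q 0 δ) (q 1 δ)).map (fun γ => γ.curve)) (Literature.Probability.RandomPlanarGeometry.CurveClass.rangeSubset (closure R'.carrier))).toReal) - Real.sqrt (1 - (((Literature.Probability.RandomPlanarGeometry.SAW.law R.carrier δ (q 1 δ) (q 2 δ)).map (fun γ => γ.curve)) (Literature.Probability.RandomPlanarGeometry.CurveClass.rangeSubset (closure R'.carrier))).toReal)| ≤ η * Real.sqrt (1 - (((Literature.Probability.RandomPlanarGeometry.SAW.law R.carrier δ (q 0 δ) (q 2 δ)).map (fun γ => γ.curve)) (Literature.Probability.RandomPlanarGeometry.CurveClass.rangeSubset (closure R'.carrier))).toReal)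

/-- item stmt-CriticalPhenomena-15265 · crux · rank 4 · open · by planner
why it might fail: (i) extracting the driving process W_t = Θ_t(γ(t)) needs a semimartingale / conditional fourth-moment a-priori without harmonic measure; (ii) hull map ⇒ point map for thin hulls; (iii) C³ regularity and non-degenerate 3-jets of the limit's Ptolemy coordinates must come from lattice data.
sources: LawlerSchrammWerner2003Restriction, Schramm2000, KemppainenSmirnov2017, Beffara2008Universal
[crux] the device, at use level (card K2 + passage to the limit): assuming BoundaryPtolemy and
RankOneBumps, every chordal family P that is the full scaling limit of the critical δℤ² SAW laws
(for every Dobrushin domain and endpoint approximation) and has two-sided restriction, a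
restriction-coupled Markov extension, reversibility, covariance under z ↦ r·i^k·z + w and
conjugation, and simple boundary-avoiding curves, is conformally covariant
(ChordalFamily.IsConformallyCovariant). Content: (a) the germ-free boundary data of P (cross-ratio
limits, same-bump avoidance ratios) define C³ Ptolemy coordinates θ_D with finite-order
singularities at growth points; (b) the continuum theorem: Ptolemy + rank one + restriction + Markov
+ dilations/translations force θ_t to flow by Loewner (V-lemma), LSW03 Prop. 5.3 backwards gives W =
√(8/3)B and b = 5/8 up to a real-linear f fixing ℝ, and D4 forces f = id. [deps: BoundaryPtolemy,
RankOneBumps] [difficulty: XL] -/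
@[route_item "route-CriticalPhenomena-SAWPtolemyBoundary", crux]
def PtolemyLoewnerRigidity : Prop :=
  BoundaryPtolemy → RankOneBumps → ∀ P : Literature.Probability.RandomPlanarGeometry.ChordalFamily, P.IsChordal → (∀ (D : Literature.Probability.RandomPlanarGeometry.DobrushinDomain) (a b : ℝ → Literature.Probability.LatticeModels.Site 2), Literature.Probability.RandomPlanarGeometry.SAW.IsEndpointApprox D a b → Literature.Probability.RandomPlanarGeometry.TendstoLaw (fun δ (γ : Literature.Probability.RandomPlanarGeometry.SAW.DomainSAW D.carrier δ (a δ) (b δ)) => γ.curve) (fun δ => Literature.Probability.RandomPlanarGeometry.SAW.law D.carrier δ (a δ) (b δ)) id (P D)) → P.IsRestriction → (∃ Q : Literature.Probability.RandomPlanarGeometry.DobrushinDomain → Literature.Probability.RandomPlanarGeometry.CurveClass ℂ → MeasureTheory.Measure (Literature.Probability.RandomPlanarGeometry.CurveClass ℂ), P.IsMarkovExtension Q ∧ ∀ (D : Literature.Probability.RandomPlanarGeometry.DobrushinDomain) (p : Literature.Probability.RandomPlanarGeometry.CurveClass ℂ) (D' : Literature.Probability.RandomPlanarGeometry.DobrushinDomain),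 D'.carrier ⊆ Literature.Probability.RandomPlanarGeometry.remainingDomain D p → D'.pt 0 = p.target → D'.pt 1 = D.pt 1 → ∀ T : Set (Literature.Probability.RandomPlanarGeometry.CurveClass ℂ), MeasurableSet T → P D' T * Q D p (Literature.Probability.RandomPlanarGeometry.CurveClass.rangeSubset (closure D'.carrier)) = Q D p (T ∩ Literature.Probability.RandomPlanarGeometry.CurveClass.rangeSubset (closure D'.carrier))) → (∀ D D' : Literature.Probability.RandomPlanarGeometry.DobrushinDomain, D'.carrier = D.carrier → D'.pt 0 = D.pt 1 → D'.pt 1 = D.pt 0 → P D' = (P D).map Literature.Probability.RandomPlanarGeometry.CurveClass.reverse) → (∀ (D : Literature.Probability.RandomPlanarGeometry.DobrushinDomain) (c : ℂ) (hc : c ≠ 0) (w : ℂ), (∃ (r : ℝ) (k : ℕ), 0 < r ∧ c = (r : ℂ) * Complex.I ^ k) → P (D.map (Literature.Probability.RandomPlanarGeometry.similarity c hc w)) = (P D).map (Literature.Probability.RandomPlanarGeometry.CurveClass.map (Literature.Probability.RandomPlanarGeometry.similarity c hc w : C(ℂ, ℂ)))) → (∀ D : Literature.Probability.RandomPlanarGeometry.DobrushinDomain,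 P (D.map Complex.conjLIE.toHomeomorph) = (P D).map (Literature.Probability.RandomPlanarGeometry.CurveClass.map (Complex.conjLIE.toHomeomorph : C(ℂ, ℂ)))) → (∀ D : Literature.Probability.RandomPlanarGeometry.DobrushinDomain, ∀ᵐ γ ∂(P D), γ ∈ Literature.Probability.RandomPlanarGeometry.CurveClass.simple ∧ γ.range ∩ frontier D.carrier ⊆ {D.pt 0, D.pt 1}) → P.IsConformallyCovariant

/-- item stmt-CriticalPhenomena-1370 · crux · rank 5 · open · by planner
why it might fail: Markov passage needs stability of SAW limits in slit domains perturbed near the tip; simplicity/boundary avoidance need no-crawling estimates not in print; restriction passage needs null touching; largest-component bookkeeping.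
sources: LawlerSchrammWerner2004SAW, Werner2007, KennedyLawler2013
[crux] every chordal family P that is the full scaling limit (lim) of the critical δℤ² SAW laws —
for every Dobrushin domain and EVERY endpoint approximation (SAW.IsEndpointApprox) — satisfies the
hypotheses of Rigidity: restriction (exact lattice identity, LSW04 §3.4.5; portmanteau on the closed
event range ⊆ closure D' plus null touching), restriction-coupled Markov (conditional future given a
lattice past = SAW of the slit graph; its conditioning into a Jordan subdomain = SAW there),
reversibility (exact), covariance under z ↦ r·i^k·z + w and conjugation (quarter-turn/conjugation
exact at each δ; dilations via (λΩ)_δ = λ·Ω_{δ/λ} and the full-filter limit; translations: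
axis-parallel w lies in δ_nℤ² along δ_n = |w|/n, then compose — no continuity in D needed),
simplicity and boundary avoidance. Sources: LawlerSchrammWerner2004SAW (arXiv:math/0204277 §3.4.5,
p.14), Werner2007 §3.2, KennedyLawler2013, DuminilCopinHammond2013. -/
@[route_item "route-CriticalPhenomena-SAWPtolemyBoundary", crux]
def AxiomsOfLimit : Prop :=
  ∀ P : Literature.Probability.RandomPlanarGeometry.ChordalFamily, P.IsChordal → (∀ (D : Literature.Probability.RandomPlanarGeometry.DobrushinDomain) (a b : ℝ → Literature.Probability.LatticeModels.Site 2), Literature.Probability.RandomPlanarGeometry.SAW.IsEndpointApprox D a b → Literature.Probability.RandomPlanarGeometry.TendstoLaw (fun δ (γ : Literature.Probability.RandomPlanarGeometry.SAW.DomainSAW D.carrier δ (a δ) (b δ)) => γ.curve) (fun δ => Literature.Probability.RandomPlanarGeometry.SAW.law D.carrier δ (a δ) (b δ)) id (P D)) → P.IsRestriction ∧ (∃ Q : Literature.Probability.RandomPlanarGeometry.DobrushinDomain → Literature.Probability.RandomPlanarGeometry.CurveClass ℂ → MeasureTheory.Measure (Literature.Probability.RandomPlanarGeometry.CurveClass ℂ),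 P.IsMarkovExtension Q ∧ ∀ (D : Literature.Probability.RandomPlanarGeometry.DobrushinDomain) (p : Literature.Probability.RandomPlanarGeometry.CurveClass ℂ) (D' : Literature.Probability.RandomPlanarGeometry.DobrushinDomain), D'.carrier ⊆ Literature.Probability.RandomPlanarGeometry.remainingDomain D p → D'.pt 0 = p.target → D'.pt 1 = D.pt 1 → ∀ T : Set (Literature.Probability.RandomPlanarGeometry.CurveClass ℂ), MeasurableSet T → P D' T * Q D p (Literature.Probability.RandomPlanarGeometry.CurveClass.rangeSubset (closure D'.carrier)) = Q D p (T ∩ Literature.Probability.RandomPlanarGeometry.CurveClass.rangeSubset (closure D'.carrier))) ∧ (∀ D D' : Literature.Probability.RandomPlanarGeometry.DobrushinDomain, D'.carrier = D.carrier → D'.pt 0 = D.pt 1 → D'.pt 1 = D.pt 0 → P D' = (P D).map Literature.Probability.RandomPlanarGeometry.CurveClass.reverse) ∧ (∀ (D : Literature.Probability.RandomPlanarGeometry.DobrushinDomain) (c : ℂ) (hc : c ≠ 0) (w : ℂ), (∃ (r : ℝ) (k : ℕ), 0 < r ∧ c = (r : ℂ) * Complex.I ^ k) → P (D.map (Literature.Probability.RandomPlanarGeometry.similarity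 c hc w)) = (P D).map (Literature.Probability.RandomPlanarGeometry.CurveClass.map (Literature.Probability.RandomPlanarGeometry.similarity c hc w : C(ℂ, ℂ)))) ∧ (∀ D : Literature.Probability.RandomPlanarGeometry.DobrushinDomain, P (D.map Complex.conjLIE.toHomeomorph) = (P D).map (Literature.Probability.RandomPlanarGeometry.CurveClass.map (Complex.conjLIE.toHomeomorph : C(ℂ, ℂ)))) ∧ (∀ D : Literature.Probability.RandomPlanarGeometry.DobrushinDomain, ∀ᵐ γ ∂(P D), γ ∈ Literature.Probability.RandomPlanarGeometry.CurveClass.simple ∧ γ.range ∩ frontier D.carrier ⊆ {D.pt 0, D.pt 1})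

/-- item stmt-CriticalPhenomena-1371 · crux · rank 6 · open · by planner
why it might fail: eventual tightness of critical SAW is open (no annulus-crossing bound at x_c); uniqueness of subsequential limits rests on avoidance-ratio convergence; an approximation-dependent limit refutes the conjunct itself.
sources: LawlerSchrammWerner2004SAW, KemppainenSmirnov2017, AizenmanBurchard1999
[crux] existence of the full scaling limit of the critical δℤ² SAW as a chordal curve family: ∃ P,
P.IsChordal ∧ (lim) for every Dobrushin domain and every endpoint approximation (the limit is NOT
identified here). Planned glued split (tenure): EventualTight ∧ simple boundary-avoiding
subsequential limits; uniqueness of subsequential limits from AvoidanceCocycleLimit +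
AvoidanceDeterminesLaw; diagonal extraction over a countable dense class of domains. Sources:
LawlerSchrammWerner2004SAW (arXiv:math/0204277 p.3 'we do not know how to prove the existence of the
limit'), KemppainenSmirnov2017 (arXiv:1212.6215 Thm 1.5), AizenmanBurchardDuke1999,
DuminilCopinHammond2013 (arXiv:1205.0401). -/
@[route_item "route-CriticalPhenomena-SAWPtolemyBoundary", crux]
def LimitExists : Prop :=
  ∃ P : Literature.Probability.RandomPlanarGeometry.ChordalFamily, P.IsChordal ∧ (∀ (D : Literature.Probability.RandomPlanarGeometry.DobrushinDomain) (a b : ℝ → Literature.Probability.LatticeModels.Site 2), Literature.Probability.RandomPlanarGeometry.SAW.IsEndpointApprox D a b → Literature.Probability.RandomPlanarGeometry.TendstoLaw (fun δ (γ : Literature.Probability.RandomPlanarGeometry.SAW.DomainSAW D.carrier δ (a δ) (b δ)) => γ.curve) (fun δ => Literature.Probability.RandomPlanarGeometry.SAW.law D.carrier δ (a δ) (b δ)) id (P D))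

/-- item stmt-CriticalPhenomena-15266 · crux · rank 9 · open · by planner
why it might fail: LSW03 (restriction + CI + simple ⇒ SLE(8/3)) is a theorem whose tree transcription may fail as stated: IsRestriction ranges over subdomains pinching at the marks, IsConformallyCovariant needs boundary extensions, 'simple boundary-avoiding' must match LSW's class; formalising it is XL.
sources: LawlerSchrammWerner2003Restriction, Werner2007
[support] shared support (stmt-CriticalPhenomena-3017, verbatim): LSW03 at κ = 8/3 in
hypothesis-free form — a chordal, conformally covariant, restriction family carried by simple
boundary-avoiding curves is chordal SLE_(8/3) in every domain (existence/uniqueness in law are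
library theorems at 8/3). [difficulty: M] -/
@[route_item "route-CriticalPhenomena-SAWPtolemyBoundary", crux]
def LSWRestrictionFact83 : Prop :=
  ∀ P : Literature.Probability.RandomPlanarGeometry.ChordalFamily, P.IsChordal → P.IsConformallyCovariant → P.IsRestriction → (∀ D : Literature.Probability.RandomPlanarGeometry.DobrushinDomain, ∀ᵐ γ ∂(P D), γ ∈ Literature.Probability.RandomPlanarGeometry.CurveClass.simple ∧ γ.range ∩ frontier D.carrier ⊆ {D.pt 0, D.pt 1}) → ∀ D : Literature.Probability.RandomPlanarGeometry.DobrushinDomain, Literature.Probability.RandomPlanarGeometry.IsSLELaw ((8 : NNReal) / 3) D (P D)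

/-- item stmt-CriticalPhenomena-1372 · support · rank 9 · open · by planner
sources: KemppainenSmirnov2017, AizenmanBurchard1999
[support] eventual tightness of the pushed-forward critical SAW laws: for every Dobrushin domain and
endpoint approximation there is δ₀ > 0 such that {(law D δ a_δ b_δ).map curve : δ ∈ (0, δ₀]} is a
tight set of measures on CurveClass ℂ — the repaired (∃ δ₀) form of the refuted all-δ statement
stmt-CriticalPhenomena-0772 suggested by its refutation; child-designate of LimitExists, shared need
of every SAW route. Intended tools: Aizenman–Burchard / Kemppainen–Smirnov Condition G2 (an
annulus-crossing bound at x_c not in print). Sources: KemppainenSmirnov2017 Thm 1.5,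
AizenmanBurchardDuke1999, DuminilCopinHammond2013. -/
@[route_item "route-CriticalPhenomena-SAWPtolemyBoundary"]
def EventualTight : Prop :=
  ∀ (D : Literature.Probability.RandomPlanarGeometry.DobrushinDomain) (a b : ℝ → Literature.Probability.LatticeModels.Site 2), Literature.Probability.RandomPlanarGeometry.SAW.IsEndpointApprox D a b → ∃ δ₀ : ℝ, 0 < δ₀ ∧ MeasureTheory.IsTightMeasureSet ((fun δ => (Literature.Probability.RandomPlanarGeometry.SAW.law D.carrier δ (a δ) (b δ)).map (fun γ => γ.curve)) '' Set.Ioc 0 δ₀)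

/-- item stmt-CriticalPhenomena-15267 · assembly · rank 1 · open · by planner
sources: LawlerSchrammWerner2003Restriction, LawlerSchrammWerner2004SAW
[assembly] BoundaryPtolemy → RankOneBumps → PtolemyLoewnerRigidity → AxiomsOfLimit → LimitExists →
LSWRestrictionFact83 → SAWScalingLimit. -/
@[route_item "route-CriticalPhenomena-SAWPtolemyBoundary"]
def Assembly : Prop :=
  BoundaryPtolemy → RankOneBumps → PtolemyLoewnerRigidity → AxiomsOfLimit → LimitExists → LSWRestrictionFact83 → SAWScalingLimit

/-! D-0027 §2.1 — DECIDING THEOREM (planner-authored via `route open/edit --closes-file`; by planner-rrepair-CriticalPhenomena-SAWPtolemyBo-f7018713-0 2026-08-16T14:35:30Z):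
its hypotheses are this route's items and its conclusion the sub-problem Statement (glue_lint), and it elaborates with this file. -/

@[closes "route-CriticalPhenomena-SAWPtolemyBoundary"] theorem closes : BoundaryPtolemy → RankOneBumps → PtolemyLoewnerRigidity → AxiomsOfLimit → LimitExists → LSWRestrictionFact83 → _root_.SAWScalingLimit := by
  -- Deciding theorem: uses every crux. From LimitExists take the full scaling-limit family `P`; AxiomsOfLimit gives the
  -- lattice-exact axioms of `P`; PtolemyLoewnerRigidity, fed with the two lattice rank conditions BoundaryPtolemy and RankOneBumps,
  -- gives conformal covariance; LSW03 at κ = 8/3 (LSWRestrictionFact83) identifies each `P D` as the chordal SLE_{8/3} law;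
  -- `integral_map` turns `TendstoLaw … id (P D)` into convergence in law to an SLE curve.
  intro hK1 hK3 hPLR hA hL h83 D a b hab
  obtain ⟨P, hPch, hlim⟩ := hL
  obtain ⟨hres, hmk, hrev, hsim, hconj, hsimple⟩ := hA P hPch hlim
  have hcc : P.IsConformallyCovariant := hPLR hK1 hK3 P hPch hlim hres hmk hrev hsim hconj hsimple
  obtain ⟨Γ, hΓ, hPD⟩ := h83 P hPch hcc hres hsimple D
  refine ⟨Γ, hΓ, Filter.Eventually.of_forall fun δ =>
    Literature.Probability.RandomPlanarGeometry.SAW.aemeasurable_curve _ _ _ _, fun f => ?_⟩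
  have key : ∫ γ, f γ ∂(P D) = ∫ ω, f (Γ ω) ∂Literature.Probability.Process.preWienerMeasure := by
    rw [hPD]
    exact MeasureTheory.integral_map hΓ.aemeasurable f.continuous.aestronglyMeasurable
  rw [← key]
  exact hlim D a b hab f

end Summit.CriticalPhenomena.SAWScalingLimit.Theses.SAWPtolemyBoundary
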